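import Literature.AnabelianGeometry.SemiGraphs.TemperedReconstructionR3SubCompat
import Literature.AnabelianGeometry.SemiGraphs.TemperedReconstructionR2bCompatProofs
import Literature.AnabelianGeometry.SemiGraphs.TemperedReconstructionR0CompatProofs
import HarnessLib

/-!
# Corollary 3.9 (compatible reading, "induced" up to twist) modulo Theorem 3.7 (iii) alone (proof-only)

Mochizuki, *Semi-graphs of anabelioids*, Publ. RIMS **42** (2006), §3, Cor. 3.9, proof pp. 42–43
[cite: MochizukiSemiAnbd2006, Cor 3.9 pp.42-43].

The tree's frozen `Hom.Induces` (v2, `TemperedReconstruction.lean`) glues the pull-back functor of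
`F : G → H` with the CHOSEN family of conjugating elements; a morphism determines that functor only up
to the choice of the family (the 2-cells of Rmk. 2.4.2 p. 21; cell finding d4-F3, ruling ξ2), so the
frozen step (R3) `InducesOfCompatible` and the assemblies `corollary_3_9_of_thm37_i_iii` /
`cor39Compat_of_thm37_i_iii` that consume it cannot close as typed.  This PROOF-ONLY module assembles
Corollary 3.9 over the compatible reading of Def. 3.8 (`IsCompatiblyQuasiGeometric`, ruling χ2) with
"induced" read UP TO TWIST — `∃ θ : F.ConjugatorFamily, Nonempty (F.chartPullbackWith θ c𝒢 cℋ ≅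
BTemp.res φ)`, spelled out inline (no new named statement) — from steps that are ALL in the tree:
(a) = (R1, every `θ`) `Hom.compat_of_chartPullbackWith_iso` (abc-iut-w4-d080) ≫ (R0′)
`isCompatiblyQuasiGeometric_of_compat` (abc-iut-w4-d083); (b)-existence = (R2′)
`quasiGeometricGraphDataCompat_of_thm37` (abc-iut-w4-d083) ≫ (R3, `∃ θ`)
`chartPullbackWith_iso_of_compatible` (abc-iut-w4-d064 `twistAbsorption_holds` + abc-iut-w4-d080);
(b)-uniqueness = (R1) ×2 + `compatible_vertexMap_eq` (abc-iut-L3-t2) + (R4) `CompatibleEdgeMapUnique_of`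
(abc-iut-L3-d2); Thm. 3.7 (i), (ii), (iv) and `EdgeLikeDistinct` by `verticialInjective_holds`,
`verticialDistinct_holds`, `maximalCompactIffVerticial_of_compactInVerticial`,
`edgeLikeDistinct_of_compactInVerticial` (abc-iut-L3-t11).  Net: `cor39UpToTwist_of_compactInVerticial`
— the single remaining input is the named fact Thm. 3.7 (iii) `CompactInVerticial`.
Nothing here takes a side on [IUTchIII] Cor. 3.12; typed ≠ discharged.
-/

open CategoryTheory

namespace Literature.AnabelianGeometry.SemiGraphs

namespace ProfiniteSemiGraph

universe u

variable {𝒢 ℋ : ProfiniteSemiGraph.{u}}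

/-- **Cor. 3.9 (a), up to twist, modulo Thm. 3.7 (iii)**: a homomorphism `φ` induced, for SOME family
`θ` of conjugating elements, by a locally open `F : G → H` is compatibly quasi-geometric ([SemiAnbd]
p. 42 (a) with p. 43 ll. 8–13). [cite: MochizukiSemiAnbd2006, Cor 3.9 pp.42-43] -/
theorem isCompatiblyQuasiGeometric_of_exists_chartPullbackWith_iso (hCV : CompactInVerticial.{u})
    (h𝒢 : Cor39Hypotheses 𝒢) (hℋ : Cor39Hypotheses ℋ) (c𝒢 : TemperedPiChart 𝒢)
    (cℋ : TemperedPiChart ℋ) (F : Hom 𝒢 ℋ) (φ : c𝒢.G →ₜ* cℋ.G) (hF : F.IsLocallyOpen)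
    (hind : ∃ θ : F.ConjugatorFamily, Nonempty (F.chartPullbackWith θ c𝒢 cℋ ≅ BTemp.res φ)) :
    IsCompatiblyQuasiGeometric φ := by
  obtain ⟨θ, hθ⟩ := hind
  obtain ⟨hV, hE⟩ := F.compat_of_chartPullbackWith_iso θ c𝒢 cℋ φ hθ
  exact isCompatiblyQuasiGeometric_of_compat verticialInjective_holds verticialDistinct_holds hCV
    (maximalCompactIffVerticial_of_compactInVerticial hCV) h𝒢 hℋ c𝒢 cℋ F φ hF hV hE

/-- **Cor. 3.9 (b), existence, up to twist, modulo Thm. 3.7 (iii)**: every compatibly quasi-geometric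
`φ` is induced, for some family `θ`, by a locally open morphism `F : G → H` ([SemiAnbd] p. 42 (b),
proof pp. 42–43: graph data (R2′) then "`φ` arises from a morphism" (R3)).
[cite: MochizukiSemiAnbd2006, Cor 3.9 pp.42-43] -/
theorem exists_hom_chartPullbackWith_iso_of_isCompatiblyQuasiGeometric (hCV : CompactInVerticial.{u})
    (h𝒢 : Cor39Hypotheses 𝒢) (hℋ : Cor39Hypotheses ℋ) (c𝒢 : TemperedPiChart 𝒢)
    (cℋ : TemperedPiChart ℋ) (φ : c𝒢.G →ₜ* cℋ.G) (hφ : IsCompatiblyQuasiGeometric φ) :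
    ∃ F : Hom 𝒢 ℋ, F.IsLocallyOpen ∧
      ∃ θ : F.ConjugatorFamily, Nonempty (F.chartPullbackWith θ c𝒢 cℋ ≅ BTemp.res φ) := by
  obtain ⟨F, hF, hV, hE⟩ :=
    quasiGeometricGraphDataCompat_of_compactInVerticial hCV 𝒢 ℋ h𝒢 hℋ c𝒢 cℋ φ hφ
  exact ⟨F, hF, chartPullbackWith_iso_of_compatible hCV h𝒢 hℋ c𝒢 cℋ F φ hF hV hE⟩

/-- **Cor. 3.9 (b), uniqueness on underlying semi-graphs, modulo Thm. 3.7 (i), (ii), (iii)** (here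
with (i), (ii) discharged): two locally open morphisms inducing the same `φ`, each for some family of
conjugating elements, have the same vertex map and the same edge map ([SemiAnbd] p. 43: the vertex of
`H` hosting `φ(Π_v)` is unique by Thm. 3.7 (ii); the edge map by (R4)).
[cite: MochizukiSemiAnbd2006, Cor 3.9 p.43] -/
theorem base_eq_of_exists_chartPullbackWith_iso (hCV : CompactInVerticial.{u})
    (h𝒢 : Cor39Hypotheses 𝒢) (hℋ : Cor39Hypotheses ℋ) (c𝒢 : TemperedPiChart 𝒢)
    (cℋ : TemperedPiChart ℋ) (F F' : Hom 𝒢 ℋ) (φ : c𝒢.G →ₜ* cℋ.G) (hF : F.IsLocallyOpen)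
    (hF' : F'.IsLocallyOpen)
    (hind : ∃ θ : F.ConjugatorFamily, Nonempty (F.chartPullbackWith θ c𝒢 cℋ ≅ BTemp.res φ))
    (hind' : ∃ θ' : F'.ConjugatorFamily, Nonempty (F'.chartPullbackWith θ' c𝒢 cℋ ≅ BTemp.res φ)) :
    F'.base.vertexMap = F.base.vertexMap ∧ F'.base.edgeMap = F.base.edgeMap := by
  obtain ⟨θ, hθ⟩ := hind
  obtain ⟨θ', hθ'⟩ := hind'
  obtain ⟨hV, hE⟩ := F.compat_of_chartPullbackWith_iso θ c𝒢 cℋ φ hθ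
  obtain ⟨hV', hE'⟩ := F'.compat_of_chartPullbackWith_iso θ' c𝒢 cℋ φ hθ'
  have hv : F'.base.vertexMap = F.base.vertexMap :=
    compatible_vertexMap_eq verticialInjective_holds verticialDistinct_holds h𝒢 hℋ c𝒢 cℋ hF' hV' hV
  exact ⟨hv, CompatibleEdgeMapUnique_of (edgeLikeDistinct_of_compactInVerticial hCV)
    verticialInjective_holds 𝒢 ℋ h𝒢 hℋ c𝒢 cℋ F' F φ hF' hF hV' hE' hV hE hv⟩

/-- **[SemiAnbd] Corollary 3.9 over the compatible reading of Def. 3.8, "induced" read up to the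
2-cells of Rmk. 2.4.2, MODULO Theorem 3.7 (iii) `CompactInVerticial` ALONE** — the shape of
`Cor39Compat` with `F.Induces c𝒢 cℋ φ` replaced by `∃ θ, Nonempty (F.chartPullbackWith θ c𝒢 cℋ ≅
BTemp.res φ)` throughout and (a) concluding compatibly quasi-geometric: (a) and (b) are the two
directions of one correspondence between locally open morphisms `G → H` (up to equality of underlying
maps of semi-graphs) and compatibly quasi-geometric continuous homomorphisms `π₁^temp(G) → π₁^temp(H)`
(up to the isomorphism class of `B^temp(−)`).  OUR rendering; every step is a landed theorem.
[cite: MochizukiSemiAnbd2006, Cor 3.9 pp.42-43] -/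
theorem cor39UpToTwist_of_compactInVerticial (hCV : CompactInVerticial.{u})
    (𝒢 ℋ : ProfiniteSemiGraph.{u}) (h𝒢 : Cor39Hypotheses 𝒢) (hℋ : Cor39Hypotheses ℋ)
    (c𝒢 : TemperedPiChart 𝒢) (cℋ : TemperedPiChart ℋ) :
    (∀ (F : Hom 𝒢 ℋ), F.IsLocallyOpen → ∀ φ : c𝒢.G →ₜ* cℋ.G,
        (∃ θ : F.ConjugatorFamily, Nonempty (F.chartPullbackWith θ c𝒢 cℋ ≅ BTemp.res φ)) →
          IsCompatiblyQuasiGeometric φ) ∧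
      ∀ φ : c𝒢.G →ₜ* cℋ.G, IsCompatiblyQuasiGeometric φ →
        ∃ F : Hom 𝒢 ℋ, F.IsLocallyOpen ∧
          (∃ θ : F.ConjugatorFamily, Nonempty (F.chartPullbackWith θ c𝒢 cℋ ≅ BTemp.res φ)) ∧
          ∀ F' : Hom 𝒢 ℋ, F'.IsLocallyOpen →
            (∃ θ' : F'.ConjugatorFamily, Nonempty (F'.chartPullbackWith θ' c𝒢 cℋ ≅ BTemp.res φ)) →
              F'.base.vertexMap = F.base.vertexMap ∧ F'.base.edgeMap = F.base.edgeMap := by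
  refine ⟨fun F hF φ hind => ?_, fun φ hφ => ?_⟩
  · exact isCompatiblyQuasiGeometric_of_exists_chartPullbackWith_iso hCV h𝒢 hℋ c𝒢 cℋ F φ hF hind
  · obtain ⟨F, hF, hind⟩ :=
      exists_hom_chartPullbackWith_iso_of_isCompatiblyQuasiGeometric hCV h𝒢 hℋ c𝒢 cℋ φ hφ
    exact ⟨F, hF, hind, fun F' hF' hind' =>
      base_eq_of_exists_chartPullbackWith_iso hCV h𝒢 hℋ c𝒢 cℋ F F' φ hF hF' hind hind'⟩

end ProfiniteSemiGraph

end Literature.AnabelianGeometry.SemiGraphs
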